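import Summits.QuantumFields.YangMills.Theorems.SandwichVariancePinchingScoreSecondMoment
import Summits.QuantumFields.YangMills.Theorems.LogConcaveChartTransportRemainderDeriv
import Summits.QuantumFields.YangMills.Theorems.LogConcaveChartTransportIsotropic

/-!
# Route `SandwichVariancePinching` — crux `QuadraticVarianceFloor` (stmt-QuantumFields-28260):
# **the variance FLOOR for a SMOOTH potential in the whitened frame** (`H₀ = 1`, `A ∈ C²`)

THE RESULT (`floorWhitened_of_contDiff`).  For `0 ≤ δ < 1`, `H` symmetric, `b ∈ ℝⁿ` and `A ∈ C²(ℝⁿ)` with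
`(1−δ)|h|² ≤ A(x+h) + A(x−h) − 2A(x) ≤ (1+δ)|h|²` for all `x, h` and the centring `∫ x_i e^{−A} = 0`:

  `(1 − 2δ)·(2 tr H² + |b|²) ≤ gE(q²) − gE(q)²`,  `q = xᵀHx + bᵀx`,  `gE(F) = ∫F e^{−A} / ∫e^{−A}`,

i.e. exactly the body of the crux `QuadraticVarianceFloor` in the frame `H₀ = 1` with `C = 2`, for smooth
potentials, with NO dimension dependence.  PROOF (planner ym-idea-3 g13's affine-dual route, PROOF-PLANS §g13,
made formal): the affine-dual inequality (V) of `…ScoreSecondMoment` with `u = Hx + b/(1+δ)`, `c = gE(q)`,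
the centring (every linear observable integrates to zero, `integral_dotProduct_mul_exp_neg_eq_zero`), and the
Cramér–Rao floor `∫e^{−A}·|w|² ≤ (1+δ)∫(w·x)²e^{−A}` (`integral_sq_dotProduct_ge`, = (V) with a linear
observable and a constant field) summed over the rows of `H`; the final algebra is
`((3−δ)/(1+δ) − 1)τ + |b|²/(1+δ) − (1−2δ)(2τ + |b|²) = (4δ²τ + (δ+2δ²)|b|²)/(1+δ) ≥ 0`.
No Brascamp–Lieb, no Helffer–Sjöstrand, no transport (Caffarelli) is used.

WHAT REMAINS for the crux BY NAME (recorded for the next seat): (M) mollification — the crux quantifies over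
merely CONTINUOUS `A`; the sandwich is linear in `A`, hence preserved by convolution with a smooth bump, and
the Gibbs moments converge (Gaussian domination of `…ScoreCalculus`), the centring being restored by a
translation; (W) whitening `x = H₀^{-1/2}y` — the tree's `Cruxes.TransportCovarianceTransfer.{exists_symm_sqrt,
sandwich_conj, integral_div_comp_mulVec, trace_conj_mul_conj, conj_dotProduct_conj}` already carry every piece.

HONEST SCOPE.  Free-hands work of the LEAD seat of crux stmt-QuantumFields-22884 (cell ym-idea-1) on planner
ym-idea-3's draft-by-design sub-line; this file proves the SMOOTH whitened case only — it does NOT close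
`QuadraticVarianceFloor` (continuous `A`, general `H₀`), `QuadraticVarianceCeiling`,
`LogConcaveChart.QuadraticCovarianceComparison` (26240), rung R2a or any summit statement; the Yang–Mills mass
gap is NOT proved by any of this.
-/

noncomputable section

namespace Summit.QuantumFields.YangMills.Theorems.SandwichVariancePinching

open MeasureTheory Real Filter Topology

variable {n : ℕ}

/-! ## The variance FLOOR for a smooth potential in the whitened frame -/

open Summit.QuantumFields.YangMills.Cruxes.TransportCovarianceTransfer in
/-- LINEAR OBSERVABLES INTEGRATE TO ZERO under the centring `∫ x_i e^{−A} = 0`: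
`∫ (w·x) e^{−A} = 0`. [folklore] -/
theorem integral_dotProduct_mul_exp_neg_eq_zero {A : (Fin n → ℝ) → ℝ} (hA : Continuous A) {δ : ℝ}
    (hδ1 : δ < 1)
    (hsw : ∀ x h : Fin n → ℝ, (1 - δ) * (h ⬝ᵥ h) ≤ A (x + h) + A (x - h) - 2 * A x ∧
      A (x + h) + A (x - h) - 2 * A x ≤ (1 + δ) * (h ⬝ᵥ h))
    (hcent : ∀ i : Fin n, ∫ x, x i * exp (-A x) = 0) (w : Fin n → ℝ) :
    ∫ x, (w ⬝ᵥ x) * exp (-A x) = 0 := by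
  obtain ⟨C₀, κ, _, hκ, hlb⟩ := exists_quadratic_lower_of_sandwich hA hδ1 hsw
  have hI : ∀ i : Fin n, Integrable fun x : Fin n → ℝ => w i * (x i * exp (-A x)) := fun i => by
    refine (integrable_mul_exp_neg_of_growth hA (continuous_apply i) hκ (by norm_num : 1 ≤ 8) hlb
      (D := 1) (fun x => ?_)).const_mul (w i)
    rw [pow_one, one_mul]
    have : |x i| ≤ ‖x‖ := by simpa [Real.norm_eq_abs] using norm_le_pi_norm x i
    linarith [norm_nonneg x]
  have e : (fun x : Fin n → ℝ => (w ⬝ᵥ x) * exp (-A x)) = fun x => ∑ i, w i * (x i * exp (-A x)) := by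
    funext x
    simp only [dotProduct, Finset.sum_mul]
    refine Finset.sum_congr rfl fun i _ => ?_
    ring
  rw [e, integral_finsetSum _ (fun i _ => hI i)]
  refine Finset.sum_eq_zero fun i _ => ?_
  rw [integral_const_mul, hcent i, mul_zero]

open Summit.QuantumFields.YangMills.Cruxes.TransportCovarianceTransfer in
/-- **CRAMÉR–RAO COVARIANCE FLOOR** (the affine-dual inequality with a linear observable and a
constant field): `∫e^{−A} · |w|² ≤ (1+δ) ∫ (w·x)² e^{−A}` for a centred, sandwiched `C²` potential.
[folklore] -/
theorem integral_sq_dotProduct_ge {A : (Fin n → ℝ) → ℝ} (hA : ContDiff ℝ 2 A) {δ : ℝ}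
    (hδ : 0 ≤ δ) (hδ1 : δ < 1)
    (hsw : ∀ x h : Fin n → ℝ, (1 - δ) * (h ⬝ᵥ h) ≤ A (x + h) + A (x - h) - 2 * A x ∧
      A (x + h) + A (x - h) - 2 * A x ≤ (1 + δ) * (h ⬝ᵥ h)) (w : Fin n → ℝ) :
    (∫ x, exp (-A x)) * (w ⬝ᵥ w) ≤ (1 + δ) * ∫ x, (w ⬝ᵥ x) ^ 2 * exp (-A x) := by
  have h1δ : 0 < 1 + δ := by linarith
  -- the linear observable as a (degenerate) quadratic observable
  set F : (Fin n → ℝ) → ℝ := fun y => y ⬝ᵥ (0 : Matrix (Fin n) (Fin n) ℝ).mulVec y + w ⬝ᵥ y with hFdef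
  have hFw : ∀ y, F y = w ⬝ᵥ y := fun y => by simp [hFdef]
  have hFc : ContDiff ℝ 1 F := contDiff_quadObs 0 w
  have hFd : ∀ x v, fderiv ℝ F x v = w ⬝ᵥ v := fun x v => by
    rw [hFdef, fderiv_quadObs (Matrix.isSymm_zero) w x v]; simp
  have hFb : ∀ x, |F x| ≤ (∑ j, |w j|) * (1 + ‖x‖) ^ 3 := fun x => by
    rw [hFw]
    have h1 : |w ⬝ᵥ x| ≤ (∑ j, |w j|) * ‖x‖ := by
      simp only [dotProduct]
      calc |∑ j, w j * x j| ≤ ∑ j, |w j * x j| := Finset.abs_sum_le_sum_abs _ _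
        _ ≤ ∑ j, |w j| * ‖x‖ := Finset.sum_le_sum fun j _ => by
            rw [abs_mul]
            exact mul_le_mul_of_nonneg_left
              (by simpa [Real.norm_eq_abs] using norm_le_pi_norm x j) (abs_nonneg _)
        _ = (∑ j, |w j|) * ‖x‖ := by rw [Finset.sum_mul]
    have hs : 0 ≤ ∑ j, |w j| := Finset.sum_nonneg fun j _ => abs_nonneg _
    have h2 : ‖x‖ ≤ (1 + ‖x‖) ^ 3 := by nlinarith [norm_nonneg x, sq_nonneg ‖x‖]
    exact h1.trans (mul_le_mul_of_nonneg_left h2 hs)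
  have hF'b : ∀ x (j : Fin n), |fderiv ℝ F x (Pi.single j 1)| ≤ (∑ i, |w i|) * (1 + ‖x‖) ^ 2 := by
    intro x j
    rw [hFd]
    simp only [dotProduct_single, mul_one]
    have h2 : (1:ℝ) ≤ (1 + ‖x‖) ^ 2 := by nlinarith [norm_nonneg x]
    exact (Finset.single_le_sum (fun i _ => abs_nonneg (w i)) (Finset.mem_univ j)).trans
      (le_mul_of_one_le_right (Finset.sum_nonneg fun i _ => abs_nonneg _) h2)
  -- affine-dual inequality with `M = 0`, `m = (1+δ)⁻¹ w`, `c = 0`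
  have key := affine_dual_ineq hA hδ hδ1 hsw 0 ((1 + δ)⁻¹ • w) hFc hFb hF'b 0
  simp only [Matrix.zero_mulVec, zero_add, Matrix.trace_zero, zero_mul, sub_zero,
    hFd, hFw] at key
  -- evaluate the constant integrands
  have e1 : ∫ x, w ⬝ᵥ ((1 + δ)⁻¹ • w) * exp (-A x) = (1 + δ)⁻¹ * (w ⬝ᵥ w) * ∫ x, exp (-A x) := by
    rw [← integral_const_mul]; congr 1; funext x
    rw [dotProduct_smul, smul_eq_mul]
  have e2 : ∫ x, ((1 + δ)⁻¹ • w) ⬝ᵥ ((1 + δ)⁻¹ • w) * exp (-A x) =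
      (1 + δ)⁻¹ ^ 2 * (w ⬝ᵥ w) * ∫ x, exp (-A x) := by
    rw [← integral_const_mul]; congr 1; funext x
    rw [dotProduct_smul, smul_dotProduct, smul_eq_mul, smul_eq_mul]; ring
  rw [e1, e2] at key
  have hZ : 0 ≤ ∫ x, exp (-A x) := integral_nonneg fun x => (exp_pos _).le
  have hww : 0 ≤ w ⬝ᵥ w := by simpa using dotProduct_self_star_nonneg w
  -- `key : 2·Z|w|²/(1+δ) − (1+δ)·Z|w|²/(1+δ)² ≤ ∫ (w·x)² e^{−A}`
  have hid : 2 * ((1 + δ)⁻¹ * (w ⬝ᵥ w) * ∫ x, exp (-A x)) -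
      (1 + δ) * ((1 + δ)⁻¹ ^ 2 * (w ⬝ᵥ w) * ∫ x, exp (-A x)) =
      (1 + δ)⁻¹ * ((∫ x, exp (-A x)) * (w ⬝ᵥ w)) := by
    field_simp
    ring
  rw [hid] at key
  have := mul_le_mul_of_nonneg_left key h1δ.le
  rwa [← mul_assoc, mul_inv_cancel₀ h1δ.ne', one_mul] at this


open Summit.QuantumFields.YangMills.Cruxes.TransportCovarianceTransfer in
/-- **THE VARIANCE FLOOR FOR A SMOOTH POTENTIAL IN THE WHITENED FRAME (`H₀ = 1`).**
For `0 ≤ δ < 1`, `H` symmetric, `b ∈ ℝⁿ` and `A ∈ C²(ℝⁿ)` with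
`(1−δ)|h|² ≤ A(x+h) + A(x−h) − 2A(x) ≤ (1+δ)|h|²` and `∫ x_i e^{−A} = 0`, the Gibbs variance of
`q = xᵀHx + bᵀx` satisfies `(1 − 2δ)·(2 tr H² + |b|²) ≤ gE(q²) − gE(q)²` — the affine-dual inequality
with `u = Hx + b/(1+δ)` plus the Cramér–Rao floor summed over the rows of `H` (planner ym-idea-3 g13's
constants, `C = 2`). [folklore] -/
theorem floorWhitened_of_contDiff {δ : ℝ} (hδ : 0 ≤ δ) (hδ1 : δ < 1)
    (H : Matrix (Fin n) (Fin n) ℝ) (b : Fin n → ℝ) {A : (Fin n → ℝ) → ℝ} (hH : H.IsSymm)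
    (hA : ContDiff ℝ 2 A)
    (hsw : ∀ x h : Fin n → ℝ, (1 - δ) * (h ⬝ᵥ h) ≤ A (x + h) + A (x - h) - 2 * A x ∧
      A (x + h) + A (x - h) - 2 * A x ≤ (1 + δ) * (h ⬝ᵥ h))
    (hcent : ∀ i : Fin n, ∫ x, x i * exp (-A x) = 0) :
    (1 - 2 * δ) * (2 * (H * H).trace + b ⬝ᵥ b) ≤
      (∫ x, (x ⬝ᵥ H.mulVec x + b ⬝ᵥ x) * (x ⬝ᵥ H.mulVec x + b ⬝ᵥ x) * exp (-A x)) / (∫ x, exp (-A x)) -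
        (∫ x, (x ⬝ᵥ H.mulVec x + b ⬝ᵥ x) * exp (-A x)) / (∫ x, exp (-A x)) *
          ((∫ x, (x ⬝ᵥ H.mulVec x + b ⬝ᵥ x) * exp (-A x)) / (∫ x, exp (-A x))) := by
  have hAc : Continuous A := hA.continuous
  have h1δ : 0 < 1 + δ := by linarith
  obtain ⟨C₀, κ, _, hκ, hlb⟩ := exists_quadratic_lower_of_sandwich hAc hδ1 hsw
  -- positivity of the partition function
  have hZint : Integrable fun x => exp (-A x) := by
    have := integrable_mul_exp_neg_of_growth hAc continuous_const hκ (by norm_num : 0 ≤ 8) hlb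
      (w := fun _ => (1:ℝ)) (D := 1) (fun x => by simp)
    simpa using this
  have hZ : 0 < ∫ x, exp (-A x) := integral_exp_pos hZint
  set Z : ℝ := ∫ x, exp (-A x) with hZdef
  -- the observable, its derivative and growth
  set q : (Fin n → ℝ) → ℝ := fun x => x ⬝ᵥ H.mulVec x + b ⬝ᵥ x with hqdef
  have hqc : ContDiff ℝ 1 q := contDiff_quadObs H b
  have hqd : ∀ x v, fderiv ℝ q x v = ((2:ℝ) • H.mulVec x + b) ⬝ᵥ v := fun x v => fderiv_quadObs hH b x v
  obtain ⟨Dq, hDq0, hDq⟩ := exists_abs_quad_le H b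
  have hqb : ∀ x, |q x| ≤ Dq * (1 + ‖x‖) ^ 3 := fun x => by
    refine (hDq x).trans (mul_le_mul_of_nonneg_left ?_ hDq0)
    nlinarith [norm_nonneg x, sq_nonneg ‖x‖]
  have hc2 := fun j : Fin n => exists_abs_affine_apply_le ((2:ℝ) • H) b j
  choose Cj hCj0 hCj using hc2
  have hq'b : ∀ x (j : Fin n), |fderiv ℝ q x (Pi.single j 1)| ≤ (∑ i, Cj i) * (1 + ‖x‖) ^ 2 := by
    intro x j
    rw [hqd, dotProduct_single, mul_one]
    have h1 : |((2:ℝ) • H.mulVec x + b) j| ≤ Cj j * (1 + ‖x‖) := by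
      have := hCj j x
      rwa [Matrix.smul_mulVec] at this
    have h2 : Cj j * (1 + ‖x‖) ≤ (∑ i, Cj i) * (1 + ‖x‖) ^ 2 := by
      have ha : Cj j ≤ ∑ i, Cj i := Finset.single_le_sum (fun i _ => hCj0 i) (Finset.mem_univ j)
      have hb : 1 + ‖x‖ ≤ (1 + ‖x‖) ^ 2 := by nlinarith [norm_nonneg x]
      exact mul_le_mul ha hb (by positivity) (Finset.sum_nonneg fun i _ => hCj0 i)
    exact h1.trans h2
  -- integrals in play
  set S2 : ℝ := ∫ x, (H.mulVec x ⬝ᵥ H.mulVec x) * exp (-A x) with hS2def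
  set Iq : ℝ := ∫ x, q x * exp (-A x) with hIqdef
  set Iqq : ℝ := ∫ x, q x * q x * exp (-A x) with hIqqdef
  set τ : ℝ := (H * H).trace with hτdef
  set s : ℝ := (1 + δ)⁻¹ with hsdef
  have hs1 : (1 + δ) * s = 1 := mul_inv_cancel₀ h1δ.ne'
  have hs0 : 0 < s := inv_pos.mpr h1δ
  -- integrability of the pieces
  obtain ⟨CH, hCH0, hCH⟩ := exists_norm_affine_le H 0
  have hS2b : ∀ x, |H.mulVec x ⬝ᵥ H.mulVec x| ≤ (n : ℝ) * CH ^ 2 * (1 + ‖x‖) ^ 2 := fun x => by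
    rw [abs_of_nonneg (by simpa using dotProduct_self_star_nonneg (H.mulVec x))]
    have h1 := dotProduct_self_le_card_mul_norm_sq (H.mulVec x)
    have h2 : ‖H.mulVec x‖ ≤ CH * (1 + ‖x‖) := by simpa using hCH x
    have h3 : ‖H.mulVec x‖ ^ 2 ≤ CH ^ 2 * (1 + ‖x‖) ^ 2 := by
      rw [← mul_pow]; exact pow_le_pow_left₀ (norm_nonneg _) h2 2
    have hn : (0:ℝ) ≤ n := Nat.cast_nonneg n
    nlinarith [mul_le_mul_of_nonneg_left h3 hn]
  have hIS2 : Integrable fun x => (H.mulVec x ⬝ᵥ H.mulVec x) * exp (-A x) :=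
    integrable_mul_exp_neg_of_growth hAc
      ((continuous_const.matrix_mulVec continuous_id).dotProduct
        (continuous_const.matrix_mulVec continuous_id)) hκ (by norm_num) hlb hS2b
  have hIq : Integrable fun x => q x * exp (-A x) :=
    integrable_mul_exp_neg_of_growth hAc hqc.continuous hκ (by norm_num) hlb hqb
  have hIqq : Integrable fun x => q x * q x * exp (-A x) :=
    integrable_mul_exp_neg_of_growth hAc (hqc.continuous.mul hqc.continuous) hκ
      (by norm_num : 3 + 3 ≤ 8) hlb (abs_mul_le_growth hqb hqb)
  have hIlin : ∀ w : Fin n → ℝ, Integrable fun x => (w ⬝ᵥ x) * exp (-A x) := fun w => by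
    refine integrable_mul_exp_neg_of_growth hAc (continuous_const.dotProduct continuous_id) hκ
      (by norm_num : 1 ≤ 8) hlb (D := ∑ j, |w j|) fun x => ?_
    rw [pow_one]
    simp only [dotProduct]
    calc |∑ j, w j * x j| ≤ ∑ j, |w j * x j| := Finset.abs_sum_le_sum_abs _ _
      _ ≤ ∑ j, |w j| * ‖x‖ := Finset.sum_le_sum fun j _ => by
          rw [abs_mul]
          exact mul_le_mul_of_nonneg_left
            (by simpa [Real.norm_eq_abs] using norm_le_pi_norm x j) (abs_nonneg _)
      _ = (∑ j, |w j|) * ‖x‖ := by rw [Finset.sum_mul]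
      _ ≤ (∑ j, |w j|) * (1 + ‖x‖) := by
          nlinarith [Finset.sum_nonneg (fun j (_ : j ∈ Finset.univ) => abs_nonneg (w j))]
  have hlin0 : ∀ w : Fin n → ℝ, ∫ x, (w ⬝ᵥ x) * exp (-A x) = 0 :=
    integral_dotProduct_mul_exp_neg_eq_zero hAc hδ1 hsw hcent
  -- (CR) summed over the rows of `H`: `Z τ ≤ (1+δ) S2`
  have hCR : Z * τ ≤ (1 + δ) * S2 := by
    have hrow := fun i : Fin n => integral_sq_dotProduct_ge hA hδ hδ1 hsw (H i)
    have hτ : τ = ∑ i, H i ⬝ᵥ H i := by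
      rw [hτdef, trace_mul_self_of_isSymm hH]
      simp [dotProduct, sq]
    have hS2sum : S2 = ∑ i, ∫ x, (H i ⬝ᵥ x) ^ 2 * exp (-A x) := by
      rw [hS2def, ← integral_finsetSum]
      · congr 1; funext x
        rw [← Finset.sum_mul]
        congr 1
        simp [dotProduct, Matrix.mulVec, sq]
      · intro i _
        have := integrable_mul_exp_neg_of_growth hAc
          ((continuous_const.dotProduct continuous_id).pow 2) hκ (by norm_num : 1 + 1 ≤ 8) hlb
          (w := fun x => (H i ⬝ᵥ x) ^ 2)
          (D := (∑ j, |H i j|) * (∑ j, |H i j|)) (fun x => by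
            have hb : ∀ y : Fin n → ℝ, |H i ⬝ᵥ y| ≤ (∑ j, |H i j|) * (1 + ‖y‖) ^ 1 := fun y => by
              rw [pow_one]
              simp only [dotProduct]
              calc |∑ j, H i j * y j| ≤ ∑ j, |H i j * y j| := Finset.abs_sum_le_sum_abs _ _
                _ ≤ ∑ j, |H i j| * ‖y‖ := Finset.sum_le_sum fun j _ => by
                    rw [abs_mul]
                    exact mul_le_mul_of_nonneg_left
                      (by simpa [Real.norm_eq_abs] using norm_le_pi_norm y j) (abs_nonneg _)
                _ = (∑ j, |H i j|) * ‖y‖ := by rw [Finset.sum_mul]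
                _ ≤ (∑ j, |H i j|) * (1 + ‖y‖) := by
                    nlinarith [Finset.sum_nonneg (fun j (_ : j ∈ Finset.univ) => abs_nonneg (H i j))]
            have := abs_mul_le_growth hb hb x
            rwa [← sq] at this)
        exact this
    rw [hτ, hS2sum, Finset.mul_sum, Finset.mul_sum]
    exact Finset.sum_le_sum fun i _ => hrow i
  -- the affine-dual inequality for `q` with `u = Hx + s•b`, `c = Iq / Z`
  have key := affine_dual_ineq hA hδ hδ1 hsw H (s • b) hqc hqb hq'b (Iq / Z)
  -- evaluate `∫ ∂_u q e^{−A}`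
  have hdu : ∀ x, fderiv ℝ q x (H.mulVec x + s • b) =
      2 * (H.mulVec x ⬝ᵥ H.mulVec x) + (((2:ℝ) * s) • H.mulVec b + H.mulVec b) ⬝ᵥ x + s * (b ⬝ᵥ b) := by
    intro x
    rw [hqd]
    have e1 : H.mulVec x ⬝ᵥ b = H.mulVec b ⬝ᵥ x := by
      rw [← dotProduct_mulVec_of_isSymm hH x b, dotProduct_comm]
    have e2 : b ⬝ᵥ H.mulVec x = H.mulVec b ⬝ᵥ x := dotProduct_mulVec_of_isSymm hH b x
    simp only [add_dotProduct, dotProduct_add, smul_dotProduct, dotProduct_smul, smul_eq_mul, e1, e2]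
    ring
  have hIdu : ∫ x, fderiv ℝ q x (H.mulVec x + s • b) * exp (-A x) = 2 * S2 + s * (b ⬝ᵥ b) * Z := by
    have e : (fun x => fderiv ℝ q x (H.mulVec x + s • b) * exp (-A x)) = fun x =>
        2 * ((H.mulVec x ⬝ᵥ H.mulVec x) * exp (-A x)) +
          ((((2:ℝ) * s) • H.mulVec b + H.mulVec b) ⬝ᵥ x) * exp (-A x) +
          s * (b ⬝ᵥ b) * exp (-A x) := by
      funext x; rw [hdu]; ring
    have hI1 : Integrable fun x => 2 * ((H.mulVec x ⬝ᵥ H.mulVec x) * exp (-A x)) +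
        ((((2:ℝ) * s) • H.mulVec b + H.mulVec b) ⬝ᵥ x) * exp (-A x) := (hIS2.const_mul 2).add (hIlin _)
    have hI2 : Integrable fun x => s * (b ⬝ᵥ b) * exp (-A x) := hZint.const_mul _
    rw [e, integral_add hI1 hI2, integral_add (hIS2.const_mul 2) (hIlin _), integral_const_mul,
      integral_const_mul, hlin0]
    ring
  -- evaluate `∫ |u|² e^{−A}`
  have hIuu : ∫ x, ((H.mulVec x + s • b) ⬝ᵥ (H.mulVec x + s • b)) * exp (-A x) =
      S2 + s ^ 2 * (b ⬝ᵥ b) * Z := by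
    have e : (fun x => ((H.mulVec x + s • b) ⬝ᵥ (H.mulVec x + s • b)) * exp (-A x)) = fun x =>
        (H.mulVec x ⬝ᵥ H.mulVec x) * exp (-A x) +
          ((((2:ℝ) * s) • H.mulVec b) ⬝ᵥ x) * exp (-A x) + s ^ 2 * (b ⬝ᵥ b) * exp (-A x) := by
      funext x
      have e1 : H.mulVec x ⬝ᵥ b = H.mulVec b ⬝ᵥ x := by
        rw [← dotProduct_mulVec_of_isSymm hH x b, dotProduct_comm]
      have e2 : b ⬝ᵥ H.mulVec x = H.mulVec b ⬝ᵥ x := dotProduct_mulVec_of_isSymm hH b x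
      simp only [add_dotProduct, dotProduct_add, smul_dotProduct, dotProduct_smul, smul_eq_mul, e1, e2]
      ring
    have hI1 : Integrable fun x => (H.mulVec x ⬝ᵥ H.mulVec x) * exp (-A x) +
        ((((2:ℝ) * s) • H.mulVec b) ⬝ᵥ x) * exp (-A x) := hIS2.add (hIlin _)
    have hI2 : Integrable fun x => s ^ 2 * (b ⬝ᵥ b) * exp (-A x) := hZint.const_mul _
    rw [e, integral_add hI1 hI2, integral_add hIS2 (hIlin _), integral_const_mul, hlin0]
    ring
  -- evaluate `∫ (q − c)² e^{−A}`
  have hIvar : ∫ x, (q x - Iq / Z) ^ 2 * exp (-A x) = Iqq - Iq ^ 2 / Z := by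
    have e : (fun x => (q x - Iq / Z) ^ 2 * exp (-A x)) = fun x =>
        q x * q x * exp (-A x) - (2 * (Iq / Z)) * (q x * exp (-A x)) + (Iq / Z) ^ 2 * exp (-A x) := by
      funext x; ring
    have hI1 : Integrable fun x => q x * q x * exp (-A x) - (2 * (Iq / Z)) * (q x * exp (-A x)) :=
      hIqq.sub (hIq.const_mul _)
    have hI2 : Integrable fun x => (Iq / Z) ^ 2 * exp (-A x) := hZint.const_mul _
    rw [e, integral_add hI1 hI2, integral_sub hIqq (hIq.const_mul _), integral_const_mul,
      integral_const_mul]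
    rw [← hIqqdef, ← hIqdef, ← hZdef]
    field_simp
    ring
  rw [hIdu, hIuu, hIvar] at key
  -- `key : 2(2 S2 + s|b|² Z) − τ Z − (1+δ)(S2 + s²|b|² Z) ≤ Iqq − Iq²/Z`
  have hbb : 0 ≤ b ⬝ᵥ b := by simpa using dotProduct_self_star_nonneg b
  have hτ0 : 0 ≤ τ := by
    rw [hτdef, trace_mul_self_of_isSymm hH]; positivity
  have hS2s : s * (Z * τ) ≤ S2 := by
    have h := mul_le_mul_of_nonneg_left hCR hs0.le
    have e : s * ((1 + δ) * S2) = S2 := by rw [← mul_assoc, mul_comm s (1 + δ), hs1, one_mul]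
    rwa [e] at h
  have hcoef : ((3 - δ) * s - 1) * τ + s * (b ⬝ᵥ b) - (1 - 2 * δ) * (2 * τ + b ⬝ᵥ b) =
      s * (4 * δ ^ 2 * τ + (δ + 2 * δ ^ 2) * (b ⬝ᵥ b)) := by
    rw [hsdef]; field_simp; ring
  have hcoef' : (1 - 2 * δ) * (2 * τ + b ⬝ᵥ b) ≤ ((3 - δ) * s - 1) * τ + s * (b ⬝ᵥ b) := by
    have : 0 ≤ s * (4 * δ ^ 2 * τ + (δ + 2 * δ ^ 2) * (b ⬝ᵥ b)) := by positivity
    linarith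
  have hmain : (1 - 2 * δ) * (2 * τ + b ⬝ᵥ b) * Z ≤ Iqq - Iq ^ 2 / Z := by
    have h3 : 0 ≤ 3 - δ := by linarith
    have hs2 : (1 + δ) * (s ^ 2 * (b ⬝ᵥ b) * Z) = s * (b ⬝ᵥ b) * Z := by
      rw [sq, ← mul_assoc, ← mul_assoc, ← mul_assoc, hs1, one_mul]
    have p1 := mul_le_mul_of_nonneg_right hcoef' hZ.le
    have p2 := mul_le_mul_of_nonneg_left hS2s h3
    nlinarith [p1, p2, key, hs2]
  -- divide by `Z`
  have hfrac : Iqq / Z - Iq / Z * (Iq / Z) = (Iqq - Iq ^ 2 / Z) / Z := by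
    field_simp
  rw [hfrac, le_div_iff₀ hZ]
  exact hmain

end Summit.QuantumFields.YangMills.Theorems.SandwichVariancePinching

end
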